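import Summits.CriticalPhenomena.PercolationContinuityZ3.Theorems.Transplant.SkelCellsConcG
import Summits.CriticalPhenomena.PercolationContinuityZ3.Theorems.Transplant.KNCellsBoxProdZ2ConcScheduleG
import HarnessLib

/-!
# L3.3: the (D) radius schedule over a planar skeleton — p3's `concRadiiGOf` with the THREE unit perturbations and the planar-offset
# inflation that the vertex-span cell geometry asks for (`Skel.WFS`), its well-formedness, and the realised values in the product's shape

builds on p205010 (kernel theorem, internal audit signed; external expert review pending) — nothing in this file uses p205010.
Lane `prim-bschramm-*`, seat `prim-bschramm-p2` (gen 3); helper file (`--supports stmt-CriticalPhenomena-4575`).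
Ruling: stmt-g7 18:38:47Z '(i) as proposed' + p3-g4 18:39:38Z (B).

`Skel.concRadiiS C gap gap' E₀ L'`:  `rQ a x := Erad (nQ a x) ⊔ off x`, `rC a x := Erad (nQ a x + 4) ⊔ off x` (`off x := ‖cen x‖₁ + 1`, the
column radius of `WFS.colQ`; INACTIVE at every run pair, where `‖x‖₁ ≤ nQ a x` by `KNCells2AnchorNorm` and `Erad` grows by `≥ 20r` per level —
`off_le_Erad`), `rB a v δ := Erad (nQ a (v+δ))` (thick, as `concRadiiGOf`), `rE := rE_prod − 1`, `ρ := ρ_prod − 2`, `rM := Frad (nQ) − L'`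
(unchanged).  So the three radii every residue port reads at run pairs — cube `E`, between-box `E`, target `F − L'` — are LITERALLY the
product's; only `Efar`/`ρ`/`Cell` move, by units.
* `off`, `concRadiiS`, `@[simp]` field lemmas;
* **`concRadiiS_WFS (hgap : ∀ n, 1 ≤ gap n) (hE₀ : 2 ≤ E₀) (hL' : 1 ≤ L') : WFS C (concRadiiS C gap gap' E₀ L')`**;
* realised values: `concRadiiS_rE_eq` (`= Frad (nS a v + 1) − 1`), `concRadiiS_ρ_eq` (`= Erad (nS a v) − 2`), `concRadiiS_rQ_eq` /
  `concRadiiS_rC_eq` (the max is inactive under `off x ≤ Erad …`), `off_le_Erad` (`20 r ≤ gap n`, `1 ≤ E₀`, `‖x‖₁ ≤ k ⇒ off x ≤ Erad k`).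
[cite: KozmaNitzan2024, §4 pp. 25–27, 30–31 (Q_v, M_v, E_{v,x}, H^j_{v,x})]
-/

noncomputable section

open scoped Classical

namespace Summit.CriticalPhenomena.PercolationContinuityZ3.Theorems

namespace Transplant

namespace Skel

open Literature.Probability.Percolation Literature.Probability.LatticeModels SimpleGraph
open BoxProdZ2 (ConcRadiiG Erad Frad nQ nS concRadiiGOf concRadiiGOf_WF Erad_mono Frad_mono Frad_le_Erad Erad_lt_Frad_succ
  nQ_mono nQ_le_nQ_add_three nQ_add_le_nS_succ mem_pair rE_eq ρ_eq ρ_le Erad_pred_le_Frad)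

variable (C : PCells) (gap gap' : ℕ → ℕ) (E₀ L' : ℕ)

/-! ## §1 The schedule -/

/-- **The column radius** of the macro-cell `x`: the planar ℓ¹-offset of its centre plus one (`WFS.colQ`). [this work] -/
def off (x : Site 2) : ℕ := (C.cen x 0).natAbs + (C.cen x 1).natAbs + 1

/-- **The (D) radius schedule over a planar skeleton** (ruling stmt-g7 18:38:47Z / p3-g4 18:39:38Z (B)). [this work] -/
def concRadiiS : ConcRadiiG where
  rQ := fun a w => max (Erad gap gap' E₀ (nQ a w)) (off C w)
  rM := fun a w => Frad gap gap' E₀ (nQ a w) - L'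
  rC := fun a w => max (Erad gap gap' E₀ (nQ a w + 4)) (off C w)
  rB := fun a v δ => Erad gap gap' E₀ (nQ a (v + stepVec δ))
  rE := fun a v δ => (concRadiiGOf C gap gap' E₀ L').rE a v δ - 1
  ρ := fun a v δ ℓ => (concRadiiGOf C gap gap' E₀ L').ρ a v δ ℓ - 2

/-- `rQ a w = E (nQ a w) ⊔ off w`. [folklore] -/
@[simp] theorem concRadiiS_rQ (a : ℕ) (w : Site 2) : (concRadiiS C gap gap' E₀ L').rQ a w = max (Erad gap gap' E₀ (nQ a w)) (off C w) := rfl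

/-- `rC a w = E (nQ a w + 4) ⊔ off w`. [folklore] -/
@[simp] theorem concRadiiS_rC (a : ℕ) (w : Site 2) :
    (concRadiiS C gap gap' E₀ L').rC a w = max (Erad gap gap' E₀ (nQ a w + 4)) (off C w) := rfl

/-- `rM a w = F (nQ a w) - L'` (unchanged). [folklore] -/
@[simp] theorem concRadiiS_rM (a : ℕ) (w : Site 2) : (concRadiiS C gap gap' E₀ L').rM a w = Frad gap gap' E₀ (nQ a w) - L' := rfl

/-- `rB a v δ = E (nQ a (v + δ))` (thick between-box, unchanged). [folklore] -/
@[simp] theorem concRadiiS_rB (a : ℕ) (v : Site 2) (δ : MDir) :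
    (concRadiiS C gap gap' E₀ L').rB a v δ = Erad gap gap' E₀ (nQ a (v + stepVec δ)) := rfl

/-- `rE a v δ = rE_prod a v δ - 1`. [folklore] -/
@[simp] theorem concRadiiS_rE (a : ℕ) (v : Site 2) (δ : MDir) :
    (concRadiiS C gap gap' E₀ L').rE a v δ = (concRadiiGOf C gap gap' E₀ L').rE a v δ - 1 := rfl

/-- `ρ a v δ ℓ = ρ_prod a v δ ℓ - 2`. [folklore] -/
@[simp] theorem concRadiiS_ρ (a : ℕ) (v : Site 2) (δ : MDir) (ℓ : ℤ) :
    (concRadiiS C gap gap' E₀ L').ρ a v δ ℓ = (concRadiiGOf C gap gap' E₀ L').ρ a v δ ℓ - 2 := rfl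

/-! ## §2 Arithmetic of the recursion -/

/-- `E₀ ≤ E n`. [folklore] -/
theorem E₀_le_Erad (n : ℕ) : E₀ ≤ Erad gap gap' E₀ n := by
  have := Erad_mono gap gap' E₀ (Nat.zero_le n); simpa using this

/-- `E₀ ≤ F n`. [folklore] -/
theorem E₀_le_Frad (n : ℕ) : E₀ ≤ Frad gap gap' E₀ n :=
  (E₀_le_Erad gap gap' E₀ (n - 1)).trans (Erad_pred_le_Frad gap gap' E₀ n)

variable {gap}

/-- `E n + 1 ≤ E (n + 1)` when every `gap ≥ 1`. [folklore] -/
theorem Erad_succ_le_Erad_succ (hgap : ∀ n, 1 ≤ gap n) (n : ℕ) : Erad gap gap' E₀ n + 1 ≤ Erad gap gap' E₀ (n + 1) :=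
  (Nat.succ_le_of_lt (Erad_lt_Frad_succ gap gap' E₀ hgap n)).trans (Frad_le_Erad gap gap' E₀ _)

/-- `E m + 1 ≤ E n` for `m < n` when every `gap ≥ 1`. [folklore] -/
theorem Erad_succ_le_Erad_of_lt (hgap : ∀ n, 1 ≤ gap n) {m n : ℕ} (h : m < n) : Erad gap gap' E₀ m + 1 ≤ Erad gap gap' E₀ n :=
  (Erad_succ_le_Erad_succ gap' E₀ hgap m).trans (Erad_mono gap gap' E₀ (Nat.succ_le_of_lt h))

/-- **The planar offset is dominated by the recursion**: `20 r ≤ gap n` everywhere and `1 ≤ E₀` give `off x ≤ E k` whenever `‖x‖₁ ≤ k` —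
so the max in `rQ`/`rC` is inactive at every pair a run visits (`KNCells2AnchorNorm`: `‖x‖₁ ≤ nQ a x` there). [this work] -/
theorem off_le_Erad (hgap : ∀ n, 20 * C.r ≤ gap n) (hE₀ : 1 ≤ E₀) {x : Site 2} {k : ℕ} (hk : (x 0).natAbs + (x 1).natAbs ≤ k) :
    off C x ≤ Erad gap gap' E₀ k := by
  -- `E₀ + 20 r k ≤ E k`
  have key : ∀ k, E₀ + 20 * C.r * k ≤ Erad gap gap' E₀ k := by
    intro k
    induction k with
    | zero => simp
    | succ k ih =>
      have h1 : Erad gap gap' E₀ k + gap (Erad gap gap' E₀ k) ≤ Erad gap gap' E₀ (k + 1) :=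
        (BoxProdZ2.Erad_add_gap_le_Frad_succ gap gap' E₀ k).trans (Frad_le_Erad gap gap' E₀ _)
      have h2 := hgap (Erad gap gap' E₀ k)
      nlinarith
  have h0 : (C.cen x 0).natAbs = 20 * C.r * (x 0).natAbs := by
    rw [PCells.cen_apply, Int.natAbs_mul, Int.natAbs_mul]; simp
  have h1 : (C.cen x 1).natAbs = 20 * C.r * (x 1).natAbs := by
    rw [PCells.cen_apply, Int.natAbs_mul, Int.natAbs_mul]; simp
  unfold off
  rw [h0, h1]
  have := key k
  have hmono : 20 * C.r * ((x 0).natAbs + (x 1).natAbs) ≤ 20 * C.r * k := Nat.mul_le_mul_left _ hk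
  nlinarith

variable (gap)

/-! ## §3 Well-formedness with slack -/

/-- **The schedule satisfies `WFS`** (every `gap ≥ 1`, `E₀ ≥ 2`, `L' ≥ 1`). [this work] -/
theorem concRadiiS_WFS (hgap : ∀ n, 1 ≤ gap n) (hE₀ : 2 ≤ E₀) (hL' : 1 ≤ L') : WFS C (concRadiiS C gap gap' E₀ L') := by
  have W := concRadiiGOf_WF C gap gap' E₀ L'
  -- product facts, restated
  have hBC : ∀ a a' v δ, a' ∈ ({a, a + 1} : Finset ℕ) →
      Erad gap gap' E₀ (nQ a' (v + stepVec δ)) ≤ Erad gap gap' E₀ (nQ a v + 3) := fun a a' v δ h => W.BC a a' v δ h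
  have hBC' : ∀ a a' v δ, a' ∈ ({a, a + 1} : Finset ℕ) →
      Erad gap gap' E₀ (nQ a (v + stepVec δ)) ≤ Erad gap gap' E₀ (nQ a' (v + stepVec δ) + 3) := fun a a' v δ h => W.BC' a a' v δ h
  have hρQ : ∀ a a' v δ ℓ, a' ∈ ({a, a + 1} : Finset ℕ) → ℓ ≤ 5 * (C.r : ℤ) →
      (concRadiiGOf C gap gap' E₀ L').ρ a' v δ ℓ ≤ Erad gap gap' E₀ (nQ a v) := fun a a' v δ ℓ h hℓ => W.ρQ a a' v δ ℓ h hℓ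
  have hρE : ∀ a v δ ℓ, (concRadiiGOf C gap gap' E₀ L').ρ a v δ ℓ ≤ (concRadiiGOf C gap gap' E₀ L').rE a v δ := W.ρE
  have hEB : ∀ a v δ, (concRadiiGOf C gap gap' E₀ L').rE a v δ ≤ Erad gap gap' E₀ (nQ a (v + stepVec δ)) := W.EB
  have hME : ∀ a v δ, Frad gap gap' E₀ (nQ a (v + stepVec δ)) - L' ≤ (concRadiiGOf C gap gap' E₀ L').rE a v δ := W.ME
  have h34 : ∀ a v, Erad gap gap' E₀ (nQ a v + 3) + 1 ≤ Erad gap gap' E₀ (nQ a v + 4) :=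
    fun a v => Erad_succ_le_Erad_succ gap' E₀ hgap _
  have hE2 : ∀ n, 2 ≤ Erad gap gap' E₀ n := fun n => hE₀.trans (E₀_le_Erad gap gap' E₀ n)
  have hrE2 : ∀ a v δ, 2 ≤ (concRadiiGOf C gap gap' E₀ L').rE a v δ := fun a v δ => by
    rw [BoxProdZ2.concRadiiGOf_rE]
    exact le_min (hE₀.trans (E₀_le_Frad gap gap' E₀ _)) (hE2 _)
  have hMF : ∀ a v δ, Frad gap gap' E₀ (nQ a (v + stepVec δ)) ≤ (concRadiiGOf C gap gap' E₀ L').rE a v δ := fun a v δ => by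
    rw [BoxProdZ2.concRadiiGOf_rE]
    exact le_min (Frad_mono gap gap' E₀ (nQ_add_le_nS_succ a v δ)) (Frad_le_Erad gap gap' E₀ _)
  refine ⟨⟨?_, ?_, ?_, ?_, ?_, ?_, ?_, ?_⟩, ?_, ?_, ?_, ?_, ?_, ?_, ?_⟩
  · -- QC
    intro a a' x h
    simp only [concRadiiS_rQ, concRadiiS_rC]
    exact max_le_max (Erad_mono gap gap' E₀ ((nQ_mono (by rcases mem_pair h with rfl | rfl <;> omega) x).trans (Nat.le_add_right _ _)))
      le_rfl
  · -- BC
    intro a a' v δ h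
    simp only [concRadiiS_rB, concRadiiS_rC]
    exact le_max_of_le_left ((hBC a a' v δ h).trans (by have := h34 a v; omega))
  · -- BC'
    intro a a' v δ h
    simp only [concRadiiS_rB, concRadiiS_rC]
    exact le_max_of_le_left ((hBC' a a' v δ h).trans (by have := h34 a' (v + stepVec δ); omega))
  · -- ρQ
    intro a a' v δ ℓ h hℓ
    simp only [concRadiiS_ρ, concRadiiS_rQ]
    exact le_max_of_le_left ((Nat.sub_le _ _).trans (hρQ a a' v δ ℓ h hℓ))
  · -- ρE
    intro a v δ ℓ
    simp only [concRadiiS_ρ, concRadiiS_rE]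
    have := hρE a v δ ℓ; omega
  · -- EB
    intro a v δ
    simp only [concRadiiS_rE, concRadiiS_rB]
    exact (Nat.sub_le _ _).trans (hEB a v δ)
  · -- EQ
    intro a v δ
    simp only [concRadiiS_rE, concRadiiS_rQ]
    exact le_max_of_le_left ((Nat.sub_le _ _).trans (hEB a v δ))
  · -- ME
    intro a v δ
    simp only [concRadiiS_rM, concRadiiS_rE]
    have := hMF a v δ; have := hrE2 a v δ; omega
  · -- BC1
    intro a a' v δ h
    simp only [concRadiiS_rB, concRadiiS_rC]
    exact le_max_of_le_left ((Nat.add_le_add_right (hBC a a' v δ h) 1).trans (h34 a v))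
  · -- BC1'
    intro a a' v δ h
    simp only [concRadiiS_rB, concRadiiS_rC]
    exact le_max_of_le_left ((Nat.add_le_add_right (hBC' a a' v δ h) 1).trans (h34 a' (v + stepVec δ)))
  · -- ρQ1
    intro a a' v δ ℓ h hℓ
    simp only [concRadiiS_ρ, concRadiiS_rQ]
    refine le_max_of_le_left ?_
    have := hρQ a a' v δ ℓ h hℓ; have := hE2 (nQ a v); omega
  · -- ρE1
    intro a v δ ℓ
    simp only [concRadiiS_ρ, concRadiiS_rE]
    have := hρE a v δ ℓ; have := hrE2 a v δ; omega
  · -- EB1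
    intro a v δ
    simp only [concRadiiS_rE, concRadiiS_rB]
    have := hEB a v δ; have := hrE2 a v δ; omega
  · -- EQ1
    intro a v δ
    simp only [concRadiiS_rE, concRadiiS_rQ]
    refine le_max_of_le_left ?_
    have := hEB a v δ; have := hrE2 a v δ; omega
  · -- colQ
    intro a x
    simp only [concRadiiS_rQ]
    exact le_max_right _ _

/-! ## §4 Realised values (the product's shape, shifts explicit) -/

/-- **Realised far-box radius**: `rE a v δ = F (nS a v + 1) − 1` when the next cube is one level up. [folklore] -/
theorem concRadiiS_rE_eq {a : ℕ} {v : Site 2} {δ : MDir} (h : nQ a (v + stepVec δ) = nS a v + 1) :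
    (concRadiiS C gap gap' E₀ L').rE a v δ = Frad gap gap' E₀ (nS a v + 1) - 1 := by
  rw [concRadiiS_rE, rE_eq C gap gap' E₀ L' h]

/-- **Realised corridor profile**: `ρ a v δ ℓ = E (nS a v) − 2` under the product's two order hypotheses. [folklore] -/
theorem concRadiiS_ρ_eq {a : ℕ} {v : Site 2} {δ : MDir} (h1 : nS a v ≤ nQ a (v + stepVec δ)) (h2 : nS a v ≤ nQ (a - 1) v) (ℓ : ℤ) :
    (concRadiiS C gap gap' E₀ L').ρ a v δ ℓ = Erad gap gap' E₀ (nS a v) - 2 := by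
  rw [concRadiiS_ρ, ρ_eq C gap gap' E₀ L' h1 h2 ℓ]

/-- The corridor profile never exceeds `E (nS a v) − 2`. [folklore] -/
theorem concRadiiS_ρ_le (a : ℕ) (v : Site 2) (δ : MDir) (ℓ : ℤ) :
    (concRadiiS C gap gap' E₀ L').ρ a v δ ℓ ≤ Erad gap gap' E₀ (nS a v) - 2 := by
  rw [concRadiiS_ρ]; exact Nat.sub_le_sub_right (ρ_le C gap gap' E₀ L' a v δ ℓ) 2

/-- **Realised cube radius**: the max is inactive once `off x ≤ E (nQ a x)`. [folklore] -/
theorem concRadiiS_rQ_eq {a : ℕ} {x : Site 2} (h : off C x ≤ Erad gap gap' E₀ (nQ a x)) :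
    (concRadiiS C gap gap' E₀ L').rQ a x = Erad gap gap' E₀ (nQ a x) := by
  rw [concRadiiS_rQ, max_eq_left h]

/-- **Realised cell radius**: the max is inactive once `off x ≤ E (nQ a x + 4)`. [folklore] -/
theorem concRadiiS_rC_eq {a : ℕ} {x : Site 2} (h : off C x ≤ Erad gap gap' E₀ (nQ a x + 4)) :
    (concRadiiS C gap gap' E₀ L').rC a x = Erad gap gap' E₀ (nQ a x + 4) := by
  rw [concRadiiS_rC, max_eq_left h]

/-- **Realised cube radius at a pair with `‖x‖₁ ≤ nQ a x`** (every run pair, `KNCells2AnchorNorm`), under `20 r ≤ gap`, `1 ≤ E₀`. [this work] -/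
theorem concRadiiS_rQ_eq_of_norm_le (hgap : ∀ n, 20 * C.r ≤ gap n) (hE₀ : 1 ≤ E₀) {a : ℕ} {x : Site 2}
    (hx : (x 0).natAbs + (x 1).natAbs ≤ nQ a x) : (concRadiiS C gap gap' E₀ L').rQ a x = Erad gap gap' E₀ (nQ a x) :=
  concRadiiS_rQ_eq C gap gap' E₀ L' (off_le_Erad C gap' E₀ hgap hE₀ hx)

end Skel

end Transplant

end Summit.CriticalPhenomena.PercolationContinuityZ3.Theorems

end
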